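import Mathlib
import HarnessLib
import Summits.MatrixMultiplication.MatrixMultiplication.Theorems.OutsiderSandwichSquarePrice

/-!
# OutsiderSandwich — THE LINEAR LADDER: which exchanges «`p` copies of `cw₂` for `q` copies of `⟨2,2,2⟩`»
hold in `T(ℂ)`, unconditionally, and where the open rungs sit
(decomp-mm lens 4 «minimal counterexample / extremal reduction», gen 36, part 5)

Route `route-MatrixMultiplication-OutsiderSandwich`; cut of record UNCHANGED:
`closes (h₁ : LaserTangency) (h₂ : LaserMergeOptimal) (h₃ : SummitIffLaserTangency) : ω(ℂ) = 2`,
`LaserMergeOptimal` (stmt-27897) the declared residual; theorem-only, definition-free support.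
Notation (parts 2–4): `T(ℂ)`, `≲`, `a = [⟨2,2,2⟩]`, `c = [cw₂]`; the linear exchanges
`L = {(p, q) ∈ ℕ² : q·a ≲ p·c}`, the rate `r* = max_{φ ∈ X(T(ℂ))} φ(a)/φ(c) ∈ [4/3, C*]`, `C* = 2^{(2ω+2)/3}/3`
(part 3: `r* = inf` of the rates of `L`; `LaserMergeOptimal ⟺ r* = C*`; FLOOR(1) `⟺ r* = 4/3`).

* §1 `L` IS A HALF-PLANE (`linearExchange_iff_rate`): `(p, q) ∈ L ⟺ q·r* ≤ p ⟺ ⌈q·r*⌉ ≤ p`, and every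
  pair with `q·C* ≤ p` is in `L` (`linearExchange_of_threshold_mul_le`, unconditional).  Since
  `C* < 8/5` (`threshold_lt`, from `ω ≤ 2.37295` [cite: LeGall2014, Table 2 and §6.3]):
  **THEOREMS `[⟨2,2,2⟩] ≲ 2·[cw₂]`, `3·[⟨2,2,2⟩] ≲ 5·[cw₂]`, `5·[⟨2,2,2⟩] ≲ 8·[cw₂]`**, while `ζ₁` refutes
  every pair with `3p < 4q` (`¬ [⟨2,2,2⟩] ≲ [cw₂]`): the price of ONE `⟨2,2,2⟩` is EXACTLY two `cw₂`
  (`linearPrice_one`).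
* §2 THE OPEN RUNGS: `(4, 3)` is g31's FLOOR(1) (`3·[⟨2,2,2⟩] ≲ 4·[cw₂]`, necessary for `ω = 2`,
  `floorOne_iff_linearExchange_four_three`), so the price of three `⟨2,2,2⟩` is `4` or `5` and
  `ω = 2 ⟺ it is 4 ∧ LaserMergeOptimal` (`exists_linearPrice_three`); the weakest open rung with `q ≤ 3`
  is `(3, 2)`: **`2·[⟨2,2,2⟩] ≲ 3·[cw₂]`** is necessary for `ω = 2`, implied by `2^{(2ω+2)/3} ≤ 9/2`
  (`ω ≤ 2.2548…`) and implies `LaserMergeOptimal → 2^{(2ω+2)/3} ≤ 9/2`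
  (`linearExchange_three_two_of_threshold`, `threshold_le_of_linearExchange_three_two`).  In rates: `ζ₁`
  REFUTES `p/q < 4/3`, this file PROVES `p/q ≥ 8/5` (sharper numerics reach down to `C*(2.37295) ≈ 1.5842`),
  and EVERY rate in `[4/3, C*]` — e.g. `4/3, 7/5, 3/2, 11/7` — is open and necessary for `ω = 2`.
The lens's census of the residual in exchange currency is therefore: UNDER the residual every rung of `L`
below `C*` and every rung of `E` (part 4) below `2^ω` is false; a single rung `(3,2) ∈ L`, `(4,3) ∈ L`,
`(4,1) ∈ E` or `(5,1) ∈ E` would, given the residual, bound `ω` by `2.2549`, `2`, `2`, `2.3219`.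

Honest tags: support only; the three unconditional rungs are consequences of the laser floor, `R̃(a) = 2^ω`
and the published bound `ω ≤ 2.37295`, read in `T(ℂ)` by Strassen duality — not new algorithms; nothing
finite is decided.  Nearest prior art: g31 `OutsiderSandwichSlopeDialExchange` (FLOOR rungs at universal
points); Fritz 2017 (arXiv:1504.03661) Thm. 8.24.
References: [cite: Strassen1988, Thm. 2.3–2.4, Thm. 3.8]; [cite: Zuiddam2018, Thm. 2.12, Cor. 2.13, Thm. 2.15];
[cite: CoppersmithWinograd1990, §6]; [cite: LeGall2014, Table 2 and §6.3].
-/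

set_option linter.dupNamespace false

noncomputable section

namespace Summit.MatrixMultiplication.MatrixMultiplication.Theorems.OutsiderSandwichLinearLadder

open Literature.Computability.AlgebraicComplexity
open Summit.MatrixMultiplication.MatrixMultiplication.Theses.OutsiderSandwich
open Summit.MatrixMultiplication.MatrixMultiplication.Theorems.OutsiderSandwichContactFace
  (gaugePoint₁_cwTensor_two gaugePoint₁_matMulTensor_two)
open Summit.MatrixMultiplication.MatrixMultiplication.Theorems.OutsiderSandwichSlopeDialCore
  (SlopeFloor SlopeCap)
open Summit.MatrixMultiplication.MatrixMultiplication.Theorems.OutsiderSandwichSlopeDial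
  (cwFloor_one_iff summit_iff_cwDial cwCap_third_iff laserTangency_of_cwFloor)
open Summit.MatrixMultiplication.MatrixMultiplication.Theorems.OutsiderSandwichFaceCertificates
open Summit.MatrixMultiplication.MatrixMultiplication.Theorems.OutsiderSandwichBundledPrice
open Summit.MatrixMultiplication.MatrixMultiplication.Theorems.OutsiderSandwichSubsidy
open Summit.MatrixMultiplication.MatrixMultiplication.Theorems.OutsiderSandwichProductLocalisation
open Summit.MatrixMultiplication.MatrixMultiplication.Theorems.OutsiderSandwichExchange
open Summit.MatrixMultiplication.MatrixMultiplication.Theorems.OutsiderSandwichResidualRate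
open Summit.MatrixMultiplication.MatrixMultiplication.Theorems.OutsiderSandwichSquarePrice

variable {F : SpectralMap ℂ}

/-! ## §1  `L` is a half-plane; unconditional rungs -/

/-- **`C* < 8/5`**: `(2ω+2)/3 ≤ 9/4` and `2^{9/4} = 512^{1/4} < 4.8`. [cite: LeGall2014, Table 2 and §6.3] -/
theorem threshold_lt : (2 : ℝ) ^ ((2 * omega ℂ + 2) / 3) / 3 < 8 / 5 := by
  have hω := LeGall2014_cw4_omega_le ℂ
  have h1 : (2 : ℝ) ^ ((2 * omega ℂ + 2) / 3) ≤ (2 : ℝ) ^ ((9 : ℝ) / 4) :=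
    Real.rpow_le_rpow_of_exponent_le one_le_two (by linarith)
  have h2 : ((2 : ℝ) ^ ((9 : ℝ) / 4)) ^ 4 = 512 := by
    rw [← Real.rpow_natCast, ← Real.rpow_mul (by norm_num : (0 : ℝ) ≤ 2)]
    norm_num
  have h0 : 0 ≤ (2 : ℝ) ^ ((9 : ℝ) / 4) := Real.rpow_nonneg (by norm_num) _
  have h3 : (2 : ℝ) ^ ((9 : ℝ) / 4) < 24 / 5 := by
    rw [← pow_lt_pow_iff_left₀ h0 (by norm_num : (0 : ℝ) ≤ 24 / 5) four_ne_zero, h2]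
    norm_num
  linarith

/-- **Unconditional rungs of `L`**: `q·C* ≤ p ⟹ q·[⟨2,2,2⟩] ≲ p·[cw₂]` (pointwise `φ(a) ≤ C*·φ(c)`).
[cite: CoppersmithWinograd1990, §6; Zuiddam2018, Thm. 2.12, Cor. 2.13; Strassen1988, Thm. 3.8] -/
theorem linearExchange_of_threshold_mul_le {p q : ℕ}
    (h : (q : ℝ) * ((2 : ℝ) ^ ((2 * omega ℂ + 2) / 3) / 3) ≤ p) :
    AsympLe (fun x y : TensorClass ℂ => x ≤ y)
      ((q : TensorClass ℂ) * TensorClass.mk (matMulTensor ℂ 2 2 2))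
      ((p : TensorClass ℂ) * TensorClass.mk (cwTensor ℂ 2)) := by
  rw [exchange_iff_forall (TensorClass.isStrassenPreorder ℂ)]
  intro φ hφ
  have h1 := (ratio_bound φ hφ).1
  have hc := (cw_pos φ hφ).le
  nlinarith [mul_le_mul_of_nonneg_left h1 (Nat.cast_nonneg q), mul_le_mul_of_nonneg_right h hc]

/-- **`L` IS A HALF-PLANE over the rate.**  For any maximiser `φ₀` of `φ(a)/φ(c)` on `X(T(ℂ))`
(`exists_exchangeRate`): `(p, q) ∈ L ⟺ q·r* ≤ p ⟺ ⌈q·r*⌉ ≤ p`. [cite: Zuiddam2018, Thm. 2.12; Strassen1988, Thm. 3.8] -/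
theorem linearExchange_iff_rate {φ₀ : TensorClass ℂ → ℝ}
    (hφ₀ : IsSpectralPoint (fun x y : TensorClass ℂ => x ≤ y) φ₀)
    (hmax : ∀ ψ, IsSpectralPoint (fun x y : TensorClass ℂ => x ≤ y) ψ →
      ψ (TensorClass.mk (matMulTensor ℂ 2 2 2)) / ψ (TensorClass.mk (cwTensor ℂ 2)) ≤
        φ₀ (TensorClass.mk (matMulTensor ℂ 2 2 2)) / φ₀ (TensorClass.mk (cwTensor ℂ 2)))
    (p q : ℕ) :
    (AsympLe (fun x y : TensorClass ℂ => x ≤ y)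
        ((q : TensorClass ℂ) * TensorClass.mk (matMulTensor ℂ 2 2 2))
        ((p : TensorClass ℂ) * TensorClass.mk (cwTensor ℂ 2)) ↔
      (q : ℝ) * (φ₀ (TensorClass.mk (matMulTensor ℂ 2 2 2)) / φ₀ (TensorClass.mk (cwTensor ℂ 2))) ≤ p) ∧
    (AsympLe (fun x y : TensorClass ℂ => x ≤ y)
        ((q : TensorClass ℂ) * TensorClass.mk (matMulTensor ℂ 2 2 2))
        ((p : TensorClass ℂ) * TensorClass.mk (cwTensor ℂ 2)) ↔
      ⌈(q : ℝ) * (φ₀ (TensorClass.mk (matMulTensor ℂ 2 2 2)) / φ₀ (TensorClass.mk (cwTensor ℂ 2)))⌉₊ ≤ p) := by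
  have h0 := cw_pos φ₀ hφ₀
  have key : AsympLe (fun x y : TensorClass ℂ => x ≤ y)
        ((q : TensorClass ℂ) * TensorClass.mk (matMulTensor ℂ 2 2 2))
        ((p : TensorClass ℂ) * TensorClass.mk (cwTensor ℂ 2)) ↔
      (q : ℝ) * (φ₀ (TensorClass.mk (matMulTensor ℂ 2 2 2)) / φ₀ (TensorClass.mk (cwTensor ℂ 2))) ≤ p := by
    rw [exchange_iff_forall (TensorClass.isStrassenPreorder ℂ)]
    constructor
    · intro H
      have h1 := H φ₀ hφ₀
      rw [mul_div_assoc', div_le_iff₀ h0]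
      exact h1
    · intro H ψ hψ
      have hψ0 := cw_pos ψ hψ
      have h1 := hmax ψ hψ
      rw [div_le_iff₀ hψ0] at h1
      have h2 : (q : ℝ) * ψ (TensorClass.mk (matMulTensor ℂ 2 2 2)) ≤
          (q : ℝ) * (φ₀ (TensorClass.mk (matMulTensor ℂ 2 2 2)) / φ₀ (TensorClass.mk (cwTensor ℂ 2))) *
            ψ (TensorClass.mk (cwTensor ℂ 2)) := by
        rw [mul_assoc]; exact mul_le_mul_of_nonneg_left h1 (Nat.cast_nonneg q)
      exact h2.trans (mul_le_mul_of_nonneg_right H hψ0.le)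
  exact ⟨key, by rw [key, Nat.ceil_le]⟩

/-- `L` is upward closed in the price `p`. [cite: Zuiddam2018, Thm. 2.12] -/
theorem linearExchange_mono {p p' q : ℕ}
    (hc : AsympLe (fun x y : TensorClass ℂ => x ≤ y)
      ((q : TensorClass ℂ) * TensorClass.mk (matMulTensor ℂ 2 2 2))
      ((p : TensorClass ℂ) * TensorClass.mk (cwTensor ℂ 2)))
    (hp : p ≤ p') :
    AsympLe (fun x y : TensorClass ℂ => x ≤ y)
      ((q : TensorClass ℂ) * TensorClass.mk (matMulTensor ℂ 2 2 2))
      ((p' : TensorClass ℂ) * TensorClass.mk (cwTensor ℂ 2)) := by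
  rw [exchange_iff_forall (TensorClass.isStrassenPreorder ℂ)] at hc ⊢
  intro φ hφ
  have h1 := hc φ hφ
  have hc0 := (cw_pos φ hφ).le
  have hp' : (p : ℝ) ≤ p' := by exact_mod_cast hp
  nlinarith [mul_le_mul_of_nonneg_right hp' hc0]

/-- **`ζ₁` refutes every pair with `3p < 4q`.** [cite: Strassen1988, Thm. 3.8] -/
theorem not_linearExchange_of_lt {p q : ℕ} (h : 3 * p < 4 * q) :
    ¬ AsympLe (fun x y : TensorClass ℂ => x ≤ y)
      ((q : TensorClass ℂ) * TensorClass.mk (matMulTensor ℂ 2 2 2))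
      ((p : TensorClass ℂ) * TensorClass.mk (cwTensor ℂ 2)) :=
  fun hc => absurd (four_mul_le_three_mul_of_linearExchange hc) (not_le.2 h)

/-- **THEOREM: `[⟨2,2,2⟩] ≲ 2·[cw₂]`** (two `cw₂` buy one `⟨2,2,2⟩`, asymptotically with `2^{o(N)}` help).
[cite: LeGall2014, Table 2 and §6.3; CoppersmithWinograd1990, §6; Zuiddam2018, Thm. 2.12, Cor. 2.13] -/
theorem linearExchange_two_one :
    AsympLe (fun x y : TensorClass ℂ => x ≤ y)
      (((1 : ℕ) : TensorClass ℂ) * TensorClass.mk (matMulTensor ℂ 2 2 2))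
      (((2 : ℕ) : TensorClass ℂ) * TensorClass.mk (cwTensor ℂ 2)) :=
  linearExchange_of_threshold_mul_le (by push_cast; linarith [threshold_lt])

/-- **THEOREM: `3·[⟨2,2,2⟩] ≲ 5·[cw₂]`.** [cite: LeGall2014, Table 2 and §6.3; CoppersmithWinograd1990, §6;
Zuiddam2018, Thm. 2.12, Cor. 2.13] -/
theorem linearExchange_five_three :
    AsympLe (fun x y : TensorClass ℂ => x ≤ y)
      (((3 : ℕ) : TensorClass ℂ) * TensorClass.mk (matMulTensor ℂ 2 2 2))
      (((5 : ℕ) : TensorClass ℂ) * TensorClass.mk (cwTensor ℂ 2)) :=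
  linearExchange_of_threshold_mul_le (by push_cast; linarith [threshold_lt])

/-- **THEOREM: `5·[⟨2,2,2⟩] ≲ 8·[cw₂]`** (rate `8/5`, just above `C* < 8/5`). [cite: LeGall2014, Table 2 and
§6.3; CoppersmithWinograd1990, §6; Zuiddam2018, Thm. 2.12, Cor. 2.13] -/
theorem linearExchange_eight_five :
    AsympLe (fun x y : TensorClass ℂ => x ≤ y)
      (((5 : ℕ) : TensorClass ℂ) * TensorClass.mk (matMulTensor ℂ 2 2 2))
      (((8 : ℕ) : TensorClass ℂ) * TensorClass.mk (cwTensor ℂ 2)) :=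
  linearExchange_of_threshold_mul_le (by push_cast; linarith [threshold_lt])

/-- **The price of one `⟨2,2,2⟩` is exactly two `cw₂`**: `IsLeast {p : [⟨2,2,2⟩] ≲ p·[cw₂]} 2`.
[cite: Strassen1988, Thm. 3.8; LeGall2014, Table 2 and §6.3] -/
theorem linearPrice_one :
    IsLeast {p : ℕ | AsympLe (fun x y : TensorClass ℂ => x ≤ y)
      (((1 : ℕ) : TensorClass ℂ) * TensorClass.mk (matMulTensor ℂ 2 2 2))
      ((p : TensorClass ℂ) * TensorClass.mk (cwTensor ℂ 2))} 2 := by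
  refine ⟨linearExchange_two_one, fun p hp => ?_⟩
  by_contra hlt
  exact not_linearExchange_of_lt (by omega) hp

/-! ## §2  The open rungs `(4, 3)` = FLOOR(1) and `(3, 2)` -/

/-- **`(4, 3) ∈ L ⟺ FLOOR(1)`**: `3·[⟨2,2,2⟩] ≲ 4·[cw₂] ⟺ SlopeFloor cw₂ (log₂3) 1`. [cite: Strassen1988, Thm. 3.8] -/
theorem floorOne_iff_linearExchange_four_three :
    SlopeFloor (cwTensor ℂ 2) (Real.logb 2 3) 1 ↔
      AsympLe (fun x y : TensorClass ℂ => x ≤ y)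
        (((3 : ℕ) : TensorClass ℂ) * TensorClass.mk (matMulTensor ℂ 2 2 2))
        (((4 : ℕ) : TensorClass ℂ) * TensorClass.mk (cwTensor ℂ 2)) := by
  rw [cwFloor_one_iff, forall_univ_iff_abstract (fun s t => 3 * s ≤ 4 * t),
    exchange_iff_forall (TensorClass.isStrassenPreorder ℂ)]
  push_cast
  exact Iff.rfl

/-- **The price of three `⟨2,2,2⟩` is `4` or `5`**, it is `4` iff FLOOR(1), and
`ω = 2 ⟺ (it is 4) ∧ LaserMergeOptimal`. [cite: Strassen1988, Thm. 2.3–2.4, Thm. 3.8; LeGall2014, Table 2 and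
§6.3; CoppersmithWinograd1990, §6] -/
theorem exists_linearPrice_three :
    ∃ p₃ : ℕ, (p₃ = 4 ∨ p₃ = 5) ∧
      IsLeast {p : ℕ | AsympLe (fun x y : TensorClass ℂ => x ≤ y)
        (((3 : ℕ) : TensorClass ℂ) * TensorClass.mk (matMulTensor ℂ 2 2 2))
        ((p : TensorClass ℂ) * TensorClass.mk (cwTensor ℂ 2))} p₃ ∧
      (SlopeFloor (cwTensor ℂ 2) (Real.logb 2 3) 1 ↔ p₃ = 4) ∧
      (_root_.MatrixMultiplication ↔ p₃ = 4 ∧ LaserMergeOptimal) := by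
  classical
  have hne : ∃ p : ℕ, AsympLe (fun x y : TensorClass ℂ => x ≤ y)
      (((3 : ℕ) : TensorClass ℂ) * TensorClass.mk (matMulTensor ℂ 2 2 2))
      ((p : TensorClass ℂ) * TensorClass.mk (cwTensor ℂ 2)) := ⟨5, linearExchange_five_three⟩
  have hspec := Nat.find_spec hne
  have hmin : ∀ p : ℕ, AsympLe (fun x y : TensorClass ℂ => x ≤ y)
      (((3 : ℕ) : TensorClass ℂ) * TensorClass.mk (matMulTensor ℂ 2 2 2))
      ((p : TensorClass ℂ) * TensorClass.mk (cwTensor ℂ 2)) ↔ Nat.find hne ≤ p :=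
    fun p => ⟨fun h => Nat.find_min' hne h, fun h => linearExchange_mono hspec h⟩
  have h5 : Nat.find hne ≤ 5 := (hmin 5).1 linearExchange_five_three
  have h4 : 4 ≤ Nat.find hne := by
    by_contra hlt
    exact not_linearExchange_of_lt (by omega) hspec
  have hfloor : SlopeFloor (cwTensor ℂ 2) (Real.logb 2 3) 1 ↔ Nat.find hne = 4 := by
    rw [floorOne_iff_linearExchange_four_three, hmin]; omega
  refine ⟨Nat.find hne, by omega, ⟨hspec, fun p hp => (hmin p).1 hp⟩, hfloor, ?_⟩
  rw [summit_iff_cwDial (show (1 : ℝ) / 3 < 1 by norm_num), cwCap_third_iff, hfloor]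

/-- **The open rung `(3, 2)` (weakest with `q ≤ 3`) from a threshold bound**: `2^{(2ω+2)/3} ≤ 9/2 ⟹ 2·[⟨2,2,2⟩] ≲ 3·[cw₂]`
(in particular from `ω ≤ 2.2548`). [cite: CoppersmithWinograd1990, §6; Zuiddam2018, Cor. 2.13] -/
theorem linearExchange_three_two_of_threshold (h : (2 : ℝ) ^ ((2 * omega ℂ + 2) / 3) ≤ 9 / 2) :
    AsympLe (fun x y : TensorClass ℂ => x ≤ y)
      (((2 : ℕ) : TensorClass ℂ) * TensorClass.mk (matMulTensor ℂ 2 2 2))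
      (((3 : ℕ) : TensorClass ℂ) * TensorClass.mk (cwTensor ℂ 2)) :=
  linearExchange_of_threshold_mul_le (by push_cast; linarith)

/-- **… and read UNDER the residual**: `2·[⟨2,2,2⟩] ≲ 3·[cw₂] ⟹ (LaserMergeOptimal → 2^{(2ω+2)/3} ≤ 9/2)`,
i.e. `ω ≤ (3·log₂(9/2) − 2)/2 ≈ 2.2549`. [cite: Zuiddam2018, Thm. 2.12, Thm. 2.15; Strassen1988, Thm. 3.8] -/
theorem threshold_le_of_linearExchange_three_two
    (h : AsympLe (fun x y : TensorClass ℂ => x ≤ y)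
      (((2 : ℕ) : TensorClass ℂ) * TensorClass.mk (matMulTensor ℂ 2 2 2))
      (((3 : ℕ) : TensorClass ℂ) * TensorClass.mk (cwTensor ℂ 2)))
    (hL : LaserMergeOptimal) : (2 : ℝ) ^ ((2 * omega ℂ + 2) / 3) ≤ 9 / 2 := by
  have h1 := laserMergeOptimal_iff_linearExchange.1 hL 3 2 h
  push_cast at h1
  linarith

/-- **`ω = 2` needs the rung `(3, 2)`** (then `C* = 4/3`). [cite: Strassen1988, Thm. 2.3–2.4] -/
theorem linearExchange_three_two_of_summit (h : _root_.MatrixMultiplication) :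
    AsympLe (fun x y : TensorClass ℂ => x ≤ y)
      (((2 : ℕ) : TensorClass ℂ) * TensorClass.mk (matMulTensor ℂ 2 2 2))
      (((3 : ℕ) : TensorClass ℂ) * TensorClass.mk (cwTensor ℂ 2)) := by
  refine linearExchange_three_two_of_threshold ?_
  rw [_root_.MatrixMultiplication_iff.1 h]
  norm_num

end Summit.MatrixMultiplication.MatrixMultiplication.Theorems.OutsiderSandwichLinearLadder

end
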